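import Mathlib
import Literature.Analysis.Fourier.HilbertTransformLineSkewAdjoint
import Literature.Analysis.Fourier.HilbertTransformLineWeightedL2
import HarnessLib

/-!
# The first-moment pairing of an odd profile with its Hilbert transform vanishes:
# `∫_ℝ ξ Ω(ξ) (HΩ)(ξ) dξ = 0`, hence `∫₀^∞ ξ (HΩ) Ω = 0` (the «moment null»)

HONEST FRAMING (cell ns-blowup GROUP B «PROFILE SEARCH», zone Z3 = the 1-D viscous gCLM/OSW sheet; human rulings
D-0035/D-0074): **a classical line-Hilbert-transform identity, kernel-checked as the first nonlocal input of the tail law /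
sign law of `SheetMomentIdentity.lean` (`SheetHalfLine.nsLine_tail_law_gCLM`, `nsLine_trivial_of_nonpos_of_a_neg`; MODEL side);
not Euler, not Navier–Stokes.** Nothing here is a statement about NS.

WHAT IS PROVED. For `f : ℝ → ℝ` ODD with `f ∈ L¹ ∩ L²`, `ξ f(ξ) ∈ L²` (NOT necessarily `L¹`: the NS-type-line tail `f ~ Aξ⁻²`
is allowed) and symmetric p.v. integrand integrable on `(0,∞)` at every point (`H = hilbertTransform`,
`Literature/Analysis/Fourier/HilbertTransformLine.lean`):
* `integral_id_mul_mul_hilbertTransform_eq_zero` — **`∫_ℝ ξ f(ξ) Hf(ξ) dξ = 0`**. This is the odd case of the moment pairing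
  `∫ ξ f Hf = (2π)⁻¹(∫f)²` that follows from King's moment formula `H[ξf] = ξHf − π⁻¹∫f` (tree:
  `hilbertTransform_mul_id_of_odd`) and skew-adjointness `∫(Hf)g = −∫f(Hg)` (tree: `integral_hilbertTransform_mul_eq_neg`).
  Since `ξf ∉ L¹` in the class of interest, skew-adjointness is applied to the pair `(f, 𝟙_{[−j,j]}·ξf)` and the moment
  formula to the truncation `f_j = 𝟙_{[−j,j]}f`; the error `∫ ξf·H(f − f_j)` is `≤ ‖ξf‖₂‖f − f_j‖₂ → 0` by Cauchy–Schwarz and the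
  tree's `L²` isometry `integral_hilbertTransform_sq_eq`, while `∫_{[−j,j]} ξ f Hf → ∫ ξ f Hf`.
* `integral_Ioi_id_mul_hilbertTransform_mul_eq_zero` — **`∫₀^∞ ξ (Hf)(ξ) f(ξ) dξ = 0`** (the integrand is even), the
  hypothesis `hmom` of `SheetHalfLine.nsLine_tail_law_gCLM` / `nsLine_trivial_of_nonpos_of_a_neg` for the genuine Hilbert transform.
All statements are classical (King, *Hilbert transforms* Vol. 1 §4.8 moment formulas; the vanishing for odd `f` is the
statement that `ξ ↦ ξ f Hf` is the `ξ`-derivative-free part of an exact autocorrelation); tagged [folklore]. No definitions.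
The spatial-truncation lemmas are the (private) ones of `HilbertTransformLineL2Density.lean`, re-proved here privately.
bears_on: LADDER-NS N5 / zone Z3 clause (i′) (CENSUS-Z3 v2.9 §0) → N1 linear core. WHAT THIS IS NOT: not NS.
-/

noncomputable section
open Set Filter Topology MeasureTheory
open scoped Real ENNReal

namespace Summit.NavierStokesRegularity.OSWSelfSimilar
namespace SheetHalfLine
open Literature.Analysis.Fourier

/-! ### Spatial truncations `g_j = 𝟙_{[−j,j]} g` (private copies of the `HilbertTransformLineL2Density` lemmas) -/

/-- `g_j ∈ L¹` for `g ∈ L²`. [folklore] -/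
private theorem mn_integrable_trunc {g : ℝ → ℝ} (hg2 : MemLp g 2) (j : ℕ) :
    Integrable ((Icc (-(j : ℝ)) j).indicator g) := by
  rw [integrable_indicator_iff measurableSet_Icc]
  haveI : IsFiniteMeasure (volume.restrict (Icc (-(j : ℝ)) j)) := ⟨by
    rw [Measure.restrict_apply_univ]; exact measure_Icc_lt_top⟩
  exact (hg2.restrict (Icc (-(j : ℝ)) j)).integrable one_le_two

/-- Off the two points `|x| = j`, the p.v. integrand of `g_j` on the window `t ∈ (0, ||x| − j|)` is `𝟙_{|x|<j}` times that of
`g`. [folklore] -/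
private theorem mn_trunc_symm_eq {g : ℝ → ℝ} {x : ℝ} {j : ℕ} {t : ℝ} (ht : 0 < t) (htd : t < |(|x| - (j : ℝ))|) :
    (Icc (-(j : ℝ)) j).indicator g (x - t) - (Icc (-(j : ℝ)) j).indicator g (x + t) =
      (if |x| < (j : ℝ) then g (x - t) - g (x + t) else 0) := by
  by_cases hx : |x| < (j : ℝ)
  · rw [if_pos hx]
    have hd : t < (j : ℝ) - |x| := by rwa [abs_sub_comm, abs_of_pos (sub_pos.2 hx)] at htd
    have h1 : x - t ∈ Icc (-(j : ℝ)) j := by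
      constructor <;> linarith [neg_abs_le x, le_abs_self x]
    have h2 : x + t ∈ Icc (-(j : ℝ)) j := by
      constructor <;> linarith [neg_abs_le x, le_abs_self x]
    rw [indicator_of_mem h1, indicator_of_mem h2]
  · rw [if_neg hx]
    push Not at hx
    rcases hx.lt_or_eq with hx | hx
    · have hd : t < |x| - (j : ℝ) := by rwa [abs_of_pos (sub_pos.2 hx)] at htd
      have h1 : x - t ∉ Icc (-(j : ℝ)) j := by
        intro h
        rcases le_or_gt 0 x with hx0 | hx0
        · rw [abs_of_nonneg hx0] at hd; linarith [h.2]
        · rw [abs_of_neg hx0] at hd; linarith [h.1]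
      have h2 : x + t ∉ Icc (-(j : ℝ)) j := by
        intro h
        rcases le_or_gt 0 x with hx0 | hx0
        · rw [abs_of_nonneg hx0] at hd; linarith [h.2]
        · rw [abs_of_neg hx0] at hd; linarith [h.1]
      rw [indicator_of_notMem h1, indicator_of_notMem h2, sub_zero]
    · exfalso; rw [← hx, sub_self, abs_zero] at htd; linarith

/-- Integrability of `t ↦ (φ(x − t) − φ(x + t))/t` on `[d, ∞)`, `d > 0`, for `φ ∈ L¹`. [folklore] -/
private theorem mn_integrableOn_shift_div {φ : ℝ → ℝ} (hφ : Integrable φ) (x : ℝ) {d : ℝ} (hd : 0 < d) :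
    IntegrableOn (fun t => (φ (x - t) - φ (x + t)) / t) (Ici d) := by
  have hA : Integrable (fun t => φ (x - t)) := hφ.comp_sub_left x
  have hB : Integrable (fun t => φ (x + t)) := hφ.comp_add_left x
  have hAB : IntegrableOn (fun t => φ (x - t) - φ (x + t)) (Ici d) := (hA.sub hB).integrableOn
  have hbound : IntegrableOn (fun t => ‖φ (x - t) - φ (x + t)‖ / d) (Ici d) := hAB.norm.div_const d
  refine Integrable.mono' hbound ?_ ?_
  · exact (hAB.aestronglyMeasurable.mul (measurable_inv.aestronglyMeasurable.restrict)).congr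
      (ae_of_all _ fun t => (div_eq_mul_inv _ _).symm)
  · rw [ae_restrict_iff' measurableSet_Ici]
    refine ae_of_all _ fun t ht => ?_
    have ht0 : 0 < t := hd.trans_le ht
    rw [norm_div, Real.norm_eq_abs t, abs_of_pos ht0]
    exact div_le_div_of_nonneg_left (norm_nonneg _) hd ht

/-- The truncations keep the p.v. hypothesis off `|x| = j`. [folklore] -/
private theorem mn_integrableOn_symmIntegrand_trunc {g : ℝ → ℝ} (hg2 : MemLp g 2) {x : ℝ} {j : ℕ}
    (hx : IntegrableOn (fun t => (g (x - t) - g (x + t)) / t) (Ioi 0)) (hxj : |x| ≠ (j : ℝ)) :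
    IntegrableOn (fun t => ((Icc (-(j : ℝ)) j).indicator g (x - t) -
      (Icc (-(j : ℝ)) j).indicator g (x + t)) / t) (Ioi 0) := by
  set d : ℝ := |(|x| - (j : ℝ))| with hd
  have hdpos : 0 < d := abs_pos.2 (sub_ne_zero.2 hxj)
  have hsplit : Ioi (0 : ℝ) = Ioo 0 d ∪ Ici d := by
    ext t; simp only [mem_Ioi, mem_union, mem_Ioo, mem_Ici]
    constructor
    · intro ht; rcases lt_or_ge t d with h | h; exacts [Or.inl ⟨ht, h⟩, Or.inr h]
    · rintro (⟨ht, _⟩ | h); exacts [ht, hdpos.trans_le h]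
  rw [hsplit]
  refine IntegrableOn.union ?_ (mn_integrableOn_shift_div (mn_integrable_trunc hg2 j) x hdpos)
  have hx' : IntegrableOn (fun t => (if |x| < (j : ℝ) then g (x - t) - g (x + t) else 0) / t) (Ioo 0 d) := by
    by_cases h : |x| < (j : ℝ)
    · simp only [if_pos h]; exact hx.mono_set Ioo_subset_Ioi_self
    · simp only [if_neg h, zero_div]; exact integrableOn_zero
  refine hx'.congr_fun (fun t ht => ?_) measurableSet_Ioo
  rw [mn_trunc_symm_eq ht.1 ht.2]

/-- The two points `|x| = j` are null: `|x| ≠ j` a.e. [folklore] -/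
private theorem mn_ae_abs_ne (j : ℕ) : ∀ᵐ x : ℝ, |x| ≠ (j : ℝ) := by
  have h0 : volume ({(j : ℝ), -(j : ℝ)} : Set ℝ) = 0 := (Set.toFinite _).measure_zero volume
  rw [ae_iff]
  refine measure_mono_null (fun x hx => ?_) h0
  simp only [ne_eq, not_not, mem_setOf_eq] at hx
  rcases (abs_eq (Nat.cast_nonneg j)).mp hx with h | h
  · simp [h]
  · simp [h]

/-- Cauchy–Schwarz for real functions in `L²`: `|∫ u v| ≤ √(∫u²) √(∫v²)`. [folklore] -/
private theorem mn_abs_integral_mul_le {u v : ℝ → ℝ} (hu : MemLp u 2) (hv : MemLp v 2) :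
    |∫ x, u x * v x| ≤ Real.sqrt (∫ x, u x ^ 2) * Real.sqrt (∫ x, v x ^ 2) := by
  have h1 : |∫ x, u x * v x| ≤ ∫ x, ‖u x‖ * ‖v x‖ := by
    refine (abs_integral_le_integral_abs).trans (le_of_eq ?_)
    refine integral_congr_ae (ae_of_all _ fun x => ?_)
    simp only [abs_mul, Real.norm_eq_abs]
  refine h1.trans ?_
  have hun : MemLp (fun x => ‖u x‖) (ENNReal.ofReal 2) volume := by
    rw [show ENNReal.ofReal 2 = 2 by simp]; exact hu.norm
  have hvn : MemLp (fun x => ‖v x‖) (ENNReal.ofReal 2) volume := by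
    rw [show ENNReal.ofReal 2 = 2 by simp]; exact hv.norm
  have h2 := integral_mul_le_Lp_mul_Lq_of_nonneg Real.HolderConjugate.two_two
    (ae_of_all _ fun x => norm_nonneg (u x)) (ae_of_all _ fun x => norm_nonneg (v x)) hun hvn
  refine h2.trans (le_of_eq ?_)
  rw [Real.sqrt_eq_rpow, Real.sqrt_eq_rpow]
  congr 2
  · refine integral_congr_ae (ae_of_all _ fun x => ?_); simp only [Real.rpow_two, Real.norm_eq_abs, sq_abs]
  · refine integral_congr_ae (ae_of_all _ fun x => ?_); simp only [Real.rpow_two, Real.norm_eq_abs, sq_abs]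

/-! ### The moment pairing on the line -/

/-- **`∫_ℝ ξ f(ξ) (Hf)(ξ) dξ = 0` for odd `f ∈ L¹ ∩ L²` with `ξf ∈ L²`** and everywhere-integrable symmetric p.v. integrand.
(Odd case of King's moment pairing; proved by spatial truncation, the moment formula `H[ξ f_j] = ξ H f_j`, skew-adjointness,
Cauchy–Schwarz and the `L²` isometry.) [folklore] -/
theorem integral_id_mul_mul_hilbertTransform_eq_zero {f : ℝ → ℝ} (hodd : ∀ y, f (-y) = -f y)
    (hf : Integrable f) (hf2 : MemLp f 2) (hxf2 : MemLp (fun y => y * f y) 2)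
    (hint : ∀ x, IntegrableOn (fun t => (f (x - t) - f (x + t)) / t) (Ioi 0)) :
    ∫ x, x * f x * hilbertTransform f x = 0 := by
  set fj : ℕ → ℝ → ℝ := fun j => (Icc (-(j : ℝ)) j).indicator f with hfj
  set gj : ℕ → ℝ → ℝ := fun j => (Icc (-(j : ℝ)) j).indicator (fun y => y * f y) with hgj
  have hHf2 : MemLp (hilbertTransform f) 2 := memLp_two_hilbertTransform hf hf2 (ae_of_all _ hint)
  have hI : Integrable (fun x => x * f x * hilbertTransform f x) := hxf2.integrable_mul hHf2
  -- the truncations f_j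
  have fj_odd : ∀ j y, fj j (-y) = -fj j y := by
    intro j y
    simp only [hfj]
    by_cases hy : y ∈ Icc (-(j : ℝ)) j
    · have hny : -y ∈ Icc (-(j : ℝ)) j := by
        constructor <;> linarith [hy.1, hy.2]
      rw [indicator_of_mem hny, indicator_of_mem hy, hodd]
    · have hny : -y ∉ Icc (-(j : ℝ)) j := by
        intro h
        exact hy ⟨by linarith [h.2], by linarith [h.1]⟩
      rw [indicator_of_notMem hny, indicator_of_notMem hy, neg_zero]
  have fj_int : ∀ j, Integrable (fj j) := fun j => hf.indicator measurableSet_Icc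
  have fj_2 : ∀ j, MemLp (fj j) 2 := fun j => hf2.indicator measurableSet_Icc
  have fj_symm : ∀ j, ∀ᵐ x : ℝ, IntegrableOn (fun t => (fj j (x - t) - fj j (x + t)) / t) (Ioi 0) := by
    intro j
    filter_upwards [mn_ae_abs_ne j] with x hx
    exact mn_integrableOn_symmIntegrand_trunc hf2 (hint x) hx
  -- the truncations g_j = ξ f_j
  have gj_eq : ∀ j, gj j = fun y => y * fj j y := by
    intro j
    funext y
    simp only [hgj, hfj]
    exact indicator_mul_right _ _ _
  have gj_int : ∀ j, Integrable (gj j) := fun j => mn_integrable_trunc hxf2 j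
  have gj_2 : ∀ j, MemLp (gj j) 2 := fun j => hxf2.indicator measurableSet_Icc
  have gj_symm : ∀ j, ∀ᵐ x : ℝ, IntegrableOn (fun t => (gj j (x - t) - gj j (x + t)) / t) (Ioi 0) := by
    intro j
    filter_upwards [mn_ae_abs_ne j] with x hx
    exact mn_integrableOn_symmIntegrand_trunc hxf2 (integrableOn_symmIntegrand_id_mul hf (hint x)) hx
  -- the remainders f − f_j
  have rj_int : ∀ j, Integrable (fun y => f y - fj j y) := fun j => hf.sub (fj_int j)
  have rj_2 : ∀ j, MemLp (fun y => f y - fj j y) 2 := fun j => hf2.sub (fj_2 j)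
  have rj_symm : ∀ j, ∀ᵐ x : ℝ,
      IntegrableOn (fun t => ((f (x - t) - fj j (x - t)) - (f (x + t) - fj j (x + t))) / t) (Ioi 0) := by
    intro j
    filter_upwards [fj_symm j] with x hx
    refine ((hint x).sub hx).congr_fun (fun t _ => ?_) measurableSet_Ioi
    simp only [Pi.sub_apply]
    ring
  have hHr2 : ∀ j, MemLp (hilbertTransform (fun y => f y - fj j y)) 2 :=
    fun j => memLp_two_hilbertTransform (rj_int j) (rj_2 j) (rj_symm j)
  have hEint : ∀ j, Integrable (fun x => x * f x * hilbertTransform (fun y => f y - fj j y) x) :=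
    fun j => hxf2.integrable_mul (hHr2 j)
  -- (1) skew-adjointness for the pair (f, g_j)
  have h1 : ∀ j, ∫ x, hilbertTransform f x * gj j x = -∫ x, f x * hilbertTransform (gj j) x :=
    fun j => integral_hilbertTransform_mul_eq_neg hf hf2 (gj_int j) (gj_2 j) (ae_of_all _ hint) (gj_symm j)
  -- (2) moment formula, a.e.: H g_j = ξ H f_j
  have h2 : ∀ j, ∀ᵐ x : ℝ, hilbertTransform (gj j) x = x * hilbertTransform (fj j) x := by
    intro j
    filter_upwards [fj_symm j] with x hx
    rw [gj_eq j]
    exact hilbertTransform_mul_id_of_odd (fj_int j) (fj_odd j) hx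
  -- (3) additivity, a.e.: H f = H f_j + H(f − f_j)
  have h3 : ∀ j, ∀ᵐ x : ℝ,
      hilbertTransform f x = hilbertTransform (fj j) x + hilbertTransform (fun y => f y - fj j y) x := by
    intro j
    filter_upwards [fj_symm j, rj_symm j] with x h1x h2x
    have h := hilbertTransform_add (f := fj j) (g := fun y => f y - fj j y) h1x h2x
    have hfun : (fun y => fj j y + (f y - fj j y)) = f := funext fun y => by ring
    rw [hfun] at h
    exact h
  -- (4) hence S_j = −I + E_j
  have h4 : ∀ j, ∫ x, hilbertTransform f x * gj j x =
      -(∫ x, x * f x * hilbertTransform f x) + ∫ x, x * f x * hilbertTransform (fun y => f y - fj j y) x := by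
    intro j
    rw [h1 j]
    have e : ∫ x, f x * hilbertTransform (gj j) x =
        ∫ x, (x * f x * hilbertTransform f x - x * f x * hilbertTransform (fun y => f y - fj j y) x) := by
      refine integral_congr_ae ?_
      filter_upwards [h2 j, h3 j] with x hx2 hx3
      rw [hx2, hx3]
      ring
    rw [e, integral_sub hI (hEint j)]
    ring
  -- (5) S_j → I (exhaustion by the windows [−j, j])
  have h5 : Tendsto (fun j : ℕ => ∫ x, hilbertTransform f x * gj j x) atTop
      (𝓝 (∫ x, x * f x * hilbertTransform f x)) := by
    have e : ∀ j : ℕ, ∫ x, hilbertTransform f x * gj j x =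
        ∫ x in Icc (-(j : ℝ)) j, x * f x * hilbertTransform f x := by
      intro j
      rw [← integral_indicator measurableSet_Icc]
      refine integral_congr_ae (ae_of_all _ fun x => ?_)
      simp only [hgj]
      by_cases hx : x ∈ Icc (-(j : ℝ)) j
      · rw [indicator_of_mem hx, indicator_of_mem hx]; ring
      · rw [indicator_of_notMem hx, indicator_of_notMem hx, mul_zero]
    simp_rw [e]
    have hmono : Monotone (fun j : ℕ => Icc (-(j : ℝ)) j) := by
      intro i j hij
      have h : (i : ℝ) ≤ j := by exact_mod_cast hij
      exact Icc_subset_Icc (by linarith) h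
    have hU : (⋃ j : ℕ, Icc (-(j : ℝ)) j) = univ := by
      ext x
      simp only [mem_iUnion, mem_Icc, mem_univ, iff_true]
      obtain ⟨n, hn⟩ := exists_nat_ge |x|
      exact ⟨n, by constructor <;> linarith [neg_abs_le x, le_abs_self x]⟩
    have h := tendsto_setIntegral_of_monotone (μ := volume) (fun j => measurableSet_Icc) hmono
      (by rw [hU]; exact hI.integrableOn)
    rwa [hU, Measure.restrict_univ] at h
  -- (6) E_j → 0 (Cauchy–Schwarz + isometry + tail of ∫ f²)
  have h6 : Tendsto (fun j : ℕ => ∫ x, x * f x * hilbertTransform (fun y => f y - fj j y) x) atTop (𝓝 0) := by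
    have hT : Tendsto (fun j : ℕ => ∫ x, (f x - fj j x) ^ 2) atTop (𝓝 0) := by
      have e : ∀ j : ℕ, ∫ x, (f x - fj j x) ^ 2 = ∫ x in (Icc (-(j : ℝ)) j)ᶜ, f x ^ 2 := by
        intro j
        rw [← integral_indicator measurableSet_Icc.compl]
        refine integral_congr_ae (ae_of_all _ fun x => ?_)
        simp only [hfj]
        by_cases hx : x ∈ Icc (-(j : ℝ)) j
        · have hxc : x ∉ (Icc (-(j : ℝ)) j)ᶜ := by rw [mem_compl_iff, not_not]; exact hx
          rw [indicator_of_mem hx, indicator_of_notMem hxc]; ring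
        · rw [indicator_of_notMem hx, indicator_of_mem (mem_compl hx)]; ring
      simp_rw [e]
      have hanti : Antitone (fun j : ℕ => (Icc (-(j : ℝ)) j)ᶜ) := by
        intro i j hij
        have h : (i : ℝ) ≤ j := by exact_mod_cast hij
        exact compl_subset_compl.mpr (Icc_subset_Icc (by linarith) h)
      have hE : (⋂ j : ℕ, (Icc (-(j : ℝ)) j)ᶜ) = ∅ := by
        ext x
        simp only [mem_iInter, mem_compl_iff, mem_Icc, not_and, mem_empty_iff_false, iff_false, not_forall,
          not_not]
        obtain ⟨n, hn⟩ := exists_nat_ge |x|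
        exact ⟨n, by linarith [neg_abs_le x], by linarith [le_abs_self x]⟩
      have h := tendsto_setIntegral_of_antitone (μ := volume) (fun j => measurableSet_Icc.compl) hanti
        ⟨0, hf2.integrable_sq.integrableOn⟩
      rwa [hE, Measure.restrict_empty, integral_zero_measure] at h
    have hbound : ∀ j : ℕ, ‖∫ x, x * f x * hilbertTransform (fun y => f y - fj j y) x‖ ≤
        Real.sqrt (∫ x, (x * f x) ^ 2) * Real.sqrt (∫ x, (f x - fj j x) ^ 2) := by
      intro j
      rw [Real.norm_eq_abs, ← integral_hilbertTransform_sq_eq (rj_int j) (rj_2 j) (rj_symm j)]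
      exact mn_abs_integral_mul_le hxf2 (hHr2 j)
    refine squeeze_zero_norm hbound ?_
    have h := ((Real.continuous_sqrt.tendsto 0).comp hT).const_mul (Real.sqrt (∫ x, (x * f x) ^ 2))
    simpa using h
  -- (7) conclude: I = −I + 0
  have h7 : Tendsto (fun j : ℕ => ∫ x, hilbertTransform f x * gj j x) atTop
      (𝓝 (-(∫ x, x * f x * hilbertTransform f x) + 0)) := by
    simp_rw [h4]
    exact tendsto_const_nhds.add h6
  have h := tendsto_nhds_unique h5 h7
  linarith

/-! ### The half-line moment null -/

/-- **THE MOMENT NULL `∫₀^∞ ξ (HΩ)(ξ) Ω(ξ) dξ = 0`** for odd `Ω ∈ L¹ ∩ L²` with `ξΩ ∈ L²` and everywhere-integrable symmetric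
p.v. integrand (the integrand `ξ (HΩ) Ω` is even: `HΩ` is even for odd `Ω`). This is the hypothesis `hmom` of
`SheetHalfLine.nsLine_tail_law_gCLM` / `nsLine_trivial_of_nonpos_of_a_neg`. [folklore] -/
theorem integral_Ioi_id_mul_hilbertTransform_mul_eq_zero {f : ℝ → ℝ} (hodd : ∀ y, f (-y) = -f y)
    (hf : Integrable f) (hf2 : MemLp f 2) (hxf2 : MemLp (fun y => y * f y) 2)
    (hint : ∀ x, IntegrableOn (fun t => (f (x - t) - f (x + t)) / t) (Ioi 0)) :
    ∫ x in Ioi (0:ℝ), x * (hilbertTransform f x * f x) = 0 := by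
  have hHf2 : MemLp (hilbertTransform f) 2 := memLp_two_hilbertTransform hf hf2 (ae_of_all _ hint)
  have hI : Integrable (fun x => x * f x * hilbertTransform f x) := hxf2.integrable_mul hHf2
  have hline := integral_id_mul_mul_hilbertTransform_eq_zero hodd hf hf2 hxf2 hint
  -- the integrand is even
  have heven : ∀ x, (-x) * f (-x) * hilbertTransform f (-x) = x * f x * hilbertTransform f x := by
    intro x
    rw [hodd, hilbertTransform_neg_arg_of_odd hodd]
    ring
  -- ∫_ℝ = ∫_{Iic 0} + ∫_{Ioi 0} and ∫_{Iic 0} = ∫_{Ioi 0}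
  have hsplit := intervalIntegral.integral_Iic_add_Ioi (b := 0) hI.integrableOn hI.integrableOn
  have hIic : ∫ x in Iic (0:ℝ), x * f x * hilbertTransform f x = ∫ x in Ioi (0:ℝ), x * f x * hilbertTransform f x := by
    have h := integral_comp_neg_Ioi 0 (fun x => x * f x * hilbertTransform f x)
    simp only [neg_zero] at h
    rw [← h]
    refine setIntegral_congr_fun measurableSet_Ioi fun x _ => ?_
    exact heven x
  rw [hIic, hline] at hsplit
  have h2 : ∫ x in Ioi (0:ℝ), x * f x * hilbertTransform f x = 0 := by linarith
  have e : ∫ x in Ioi (0:ℝ), x * (hilbertTransform f x * f x) = ∫ x in Ioi (0:ℝ), x * f x * hilbertTransform f x :=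
    setIntegral_congr_fun measurableSet_Ioi fun x _ => by ring
  rw [e]
  exact h2

end SheetHalfLine
end Summit.NavierStokesRegularity.OSWSelfSimilar
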